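import Summits.KontsevichZagierPeriods.KontsevichZagierPeriods.Theses.FurushoPentagon
import Literature.NumberTheory.Transcendental.AssociatorsPentagonWeightTwo
import Literature.NumberTheory.Transcendental.DrinfeldAssociatorPentagonProofs
import Literature.NumberTheory.Transcendental.DrinfeldAssociatorIsGroupLikeProofs
import Literature.NumberTheory.Transcendental.MultipleZetaProofs
import Literature.NumberTheory.Transcendental.MultipleZetaValuesHoffmanProofs

/-!
# `KernelModuloPeriodConjecture` (stmt-KontsevichZagierPeriods-15058), line `Sketch`: the algebraic
# leaf has no integral and no depth-compatible form

Cdisprove unit of the crux `KernelModuloPeriodConjecture` (route `FurushoPentagon`). Two natural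
strengthenings of the registered stub `stub_associatorHoffmanSpanning` (Hoffman reduction of every
admissible coefficient at every group-like pentagon solution over every reduced commutative
`ℚ`-algebra, with RATIONAL coefficients on Hoffman indices of the SAME WEIGHT) are refuted by one small
model, the tree's real Drinfeld associator `Φ_KZ ∈ ℝ⟨⟨X₀,X₁⟩⟩` (`drinfeldAssociator`; group-like and
a pentagon solution by the tree theorems `drinfeldAssociator_isGroupLike_holds`,
`drinfeldAssociator_pentagon_holds`; convergent coefficients `(−1)^{depth} ζ(s)`,
`drinfeldAssociator_binaryWord`):

* `not_stubAIntegral` — INTEGER coefficients are impossible: at `s = (4)` the pentagon forces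
  `3 c_{X₀³X₁} = −4 c_{X₀X₁X₀X₁}` (`pentagon_weight_four_ratio`, from the tree's
  `DrinfeldPentagon.apply_weight_four'`), an integral certificate `n` gives `(3n+4) c_{X₀X₁X₀X₁} = 0`,
  and `c_{X₀X₁X₀X₁}(Φ_KZ) = ζ(2,2) > 0`. So in the line's transfer the passage to `P_ℚ = ℚ ⊗ P` (G1)
  and the proved `IntegerDivision` (G2) are NECESSARY, not artefacts: the universal Hoffman
  certificates have genuine denominators (weight 4: `3`).
* `not_stubADepthCompatible` — no DEPTH-NON-INCREASING Hoffman reduction: `s = (4)` has depth 1, the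
  only weight-4 Hoffman index `(2,2)` has depth 2, so a depth-compatible certificate is empty and
  would force `c_{X₀³X₁} ≡ 0` on pentagon solutions, but `c_{X₀³X₁}(Φ_KZ) = −ζ(4) ≠ 0`. (Hoffman
  spanning is not a depth-filtered statement — relevant to depth-graded approaches to the crux.)

Sources: H. Furusho, Publ. RIMS 39 (2003), Prop. 3.2.3; H. Furusho, Ann. of Math. 171 (2010), §3;
F. Brown, Ann. of Math. 175 (2012), Thm 1.1; D. Zagier, ECM 1994, §1.
-/

noncomputable section

namespace Summit.KontsevichZagierPeriods.KernelModuloPeriodConjecture.Negative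

open Literature.NumberTheory.Transcendental

/-! A Hoffman index of weight `4` is `(2,2)`: tree theorem `MZV.eq_of_isHoffman_of_weight_eq_four`. -/

/-- `c_{X₀X₁X₀X₁}(Φ_KZ) = ζ(2,2) > 0`. [cite: Furusho2003, Prop. 3.2.3] -/
theorem drinfeldAssociator_xyxy_pos : 0 < drinfeldAssociator [false, true, false, true] := by
  have hadm : MZV.IsAdmissible [2, 2] := ⟨by decide, by decide⟩
  have h := drinfeldAssociator_binaryWord hadm
  have hw : MZV.binaryWord [2, 2] = [false, true, false, true] := by decide
  rw [hw] at h
  rw [h]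
  have hpos := multipleZeta_pos_of_isAdmissible_holds hadm
  simpa using hpos

/-- `c_{X₀X₀X₀X₁}(Φ_KZ) = −ζ(4) ≠ 0`. [cite: Furusho2003, Prop. 3.2.3] -/
theorem drinfeldAssociator_xxxy_ne_zero : drinfeldAssociator [false, false, false, true] ≠ 0 := by
  have hadm : MZV.IsAdmissible [4] := ⟨by decide, by decide⟩
  have h := drinfeldAssociator_binaryWord hadm
  have hw : MZV.binaryWord [4] = [false, false, false, true] := by decide
  rw [hw] at h
  rw [h]
  have hpos := multipleZeta_pos_of_isAdmissible_holds hadm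
  simp only [List.length_singleton, pow_one, neg_mul, one_mul, ne_eq, neg_eq_zero]
  exact hpos.ne'

/-- **The pentagon in weight 4: `3 c_{X₀³X₁} = −4 c_{X₀X₁X₀X₁}`** at every group-like pentagon solution
over any commutative `ℚ`-algebra (from the tree's `DrinfeldPentagon.apply_weight_four'`; for `Φ_KZ`:
`3ζ(4) = 4ζ(2,2)`). [cite: Furusho2010, §3] -/
theorem pentagon_weight_four_ratio {R : Type} [CommRing R] [Algebra ℚ R] {φ : NCSeries Bool R}
    (hg : NCSeries.IsGroupLike φ) (h5 : NCSeries.DrinfeldPentagon φ) :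
    3 * φ [false, false, false, true] = -4 * φ [false, true, false, true] := by
  have hx := h5.apply_letter_eq_zero_of_isGroupLike hg false
  have hy := h5.apply_letter_eq_zero_of_isGroupLike hg true
  obtain ⟨e1, -, e3, -⟩ := h5.apply_weight_four' hg.apply_nil hx hy
  have h15 : (15 : R) * φ [false, false, false, true] = -20 * φ [false, true, false, true] := by
    linear_combination 3 * e1 + 2 * e3
  have h5u : IsUnit (algebraMap ℚ R 5) := (IsUnit.mk0 (5 : ℚ) (by norm_num)).map _
  refine h5u.mul_left_cancel ?_
  rw [map_ofNat]
  linear_combination h15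

/-- **`not_stubAIntegral`: the algebraic leaf has no integral form.** With `b : List ℕ →₀ ℤ` in place
of `→₀ ℚ` the leaf fails at `s = (4)`: `(3n + 4) ζ(2,2) = 0` is impossible for `n ∈ ℤ`. [folklore] -/
theorem not_stubAIntegral :
    ¬ ∀ s : List ℕ, MZV.IsAdmissible s → ∃ b : List ℕ →₀ ℤ,
      (∀ t ∈ b.support, MZV.IsHoffman t ∧ MZV.weight t = MZV.weight s) ∧
      ∀ (R : Type) [CommRing R] [Algebra ℚ R] [IsReduced R] (φ : NCSeries Bool R),
        NCSeries.IsGroupLike φ → NCSeries.DrinfeldPentagon φ →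
          φ (MZV.binaryWord s) = b.sum (fun t n => n • φ (MZV.binaryWord t)) := by
  intro h
  obtain ⟨b, hb, hφ⟩ := h [4] ⟨by decide, by decide⟩
  have hsupp : ∀ t ∈ b.support, t = [2, 2] := fun t ht =>
    MZV.eq_of_isHoffman_of_weight_eq_four (hb t ht).1 (by simpa [MZV.weight] using (hb t ht).2)
  have hΦ := hφ ℝ drinfeldAssociator drinfeldAssociator_isGroupLike_holds drinfeldAssociator_pentagon_holds
  classical
  rw [Finsupp.sum_of_support_subset b (s := {[2, 2]})
      (fun t ht => Finset.mem_singleton.mpr (hsupp t ht)) _ (fun t _ => by simp),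
    Finset.sum_singleton] at hΦ
  have hw4 : MZV.binaryWord [4] = [false, false, false, true] := by decide
  have hw22 : MZV.binaryWord [2, 2] = [false, true, false, true] := by decide
  rw [hw4, hw22, zsmul_eq_mul] at hΦ
  have hpent := pentagon_weight_four_ratio drinfeldAssociator_isGroupLike_holds
    drinfeldAssociator_pentagon_holds
  have hpos := drinfeldAssociator_xyxy_pos
  have hkey : ((3 : ℝ) * (b [2, 2] : ℝ) + 4) * drinfeldAssociator [false, true, false, true] = 0 := by
    linear_combination -3 * hΦ + hpent
  have hn : (3 : ℝ) * (b [2, 2] : ℝ) + 4 = 0 := by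
    rcases mul_eq_zero.mp hkey with h0 | h0
    · exact h0
    · exact absurd h0 hpos.ne'
  have hint : (3 : ℤ) * b [2, 2] + 4 = 0 := by exact_mod_cast hn
  omega

/-- **`not_stubADepthCompatible`: Hoffman reduction cannot respect the depth filtration.** With the
certificate additionally supported on Hoffman indices of depth `≤ depth s` the leaf fails at `s = (4)`:
the certificate is empty and `c_{X₀³X₁}(Φ_KZ) = −ζ(4) ≠ 0`. [folklore] -/
theorem not_stubADepthCompatible :
    ¬ ∀ s : List ℕ, MZV.IsAdmissible s → ∃ b : List ℕ →₀ ℚ,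
      (∀ t ∈ b.support, MZV.IsHoffman t ∧ MZV.weight t = MZV.weight s ∧ MZV.depth t ≤ MZV.depth s) ∧
      ∀ (R : Type) [CommRing R] [Algebra ℚ R] [IsReduced R] (φ : NCSeries Bool R),
        NCSeries.IsGroupLike φ → NCSeries.DrinfeldPentagon φ →
          φ (MZV.binaryWord s) = b.sum (fun t q => q • φ (MZV.binaryWord t)) := by
  intro h
  obtain ⟨b, hb, hφ⟩ := h [4] ⟨by decide, by decide⟩
  have hsupp : b.support = ∅ := by
    ext t
    simp only [Finset.notMem_empty, iff_false]
    intro ht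
    obtain ⟨hH, hw, hd⟩ := hb t ht
    have := MZV.eq_of_isHoffman_of_weight_eq_four hH (by simpa [MZV.weight] using hw)
    subst this
    simp [MZV.depth] at hd
  have hb0 : b = 0 := Finsupp.support_eq_empty.mp hsupp
  have hΦ := hφ ℝ drinfeldAssociator drinfeldAssociator_isGroupLike_holds drinfeldAssociator_pentagon_holds
  rw [hb0, Finsupp.sum_zero_index] at hΦ
  have hw4 : MZV.binaryWord [4] = [false, false, false, true] := by decide
  rw [hw4] at hΦ
  exact drinfeldAssociator_xxxy_ne_zero hΦ

end Summit.KontsevichZagierPeriods.KernelModuloPeriodConjecture.Negative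

end
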